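import Mathlib.LinearAlgebra.Matrix.DotProduct
import Mathlib.Data.Matrix.Mul
import Mathlib.Analysis.Complex.Basic
import Mathlib.Tactic.LinearCombination
import HarnessLib

/-!
# Crux `WeilTwelvefoldsSqrtMinus7` (stmt-HodgeConjecture-1261) · the brane no-go lemma of card `klein-square-cm-branes`

Route `HeckePrymWeil` (sub-problem `HodgeConjecture`); lead seat a1 of crux `WeilTwelvefoldsSqrtMinus7`.
The ideator-3 sketch (`Cruxes/WeilTwelvefoldsSqrtMinus7/IdeatorThreeSketch.lean`, Part A) states, as an
unproved `def BraneNoGo : Prop`, the linear-algebra core of the "brane no-go" at the CM-split anchor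
`Eⁿ × Ēⁿ` of a Weil-type abelian `2n`-fold: a Weil deformation direction `X ∈ Mₙ(ℂ)` acts on tangent
data `(a, b) ∈ ℂⁿ × ℂⁿ` by the conjugate-linear operator `(a, b) ↦ (X · b̄, Xᵀ · ā)`, and an abelian
subvariety with tangent space `S` survives to first order along `X` iff this operator maps `S` into `S`.
This file PROVES it (Mathlib only): for `n ≥ 2` the only complex subspaces of `ℂⁿ × ℂⁿ` stable under
every such operator are `⊥` and `⊤` (`braneNoGo`), together with the `n = 1` exception
(`braneNoGo_rankOne_exception`: the line spanned by `(1, m)`, `|m| = 1`, is stable).  Consequence recorded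
by the triage of the card (TRIAGE-r1-2, razor R): no proper non-zero abelian subvariety of the CM anchor
deforms with the general `ℚ(√-7)`-Weil twelvefold, so sub-torus cycles cannot carry the Weil classes off
the anchor.
-/

noncomputable section

-- every declaration of this problem lives in `Summit.HodgeConjecture.HodgeConjecture.…` (summit = sub-problem)
set_option linter.dupNamespace false

namespace Summit.HodgeConjecture.HodgeConjecture.Theorems.WeilTwelvefoldsSqrtMinus7.KleinSquareCmBranes

open Matrix
open scoped ComplexOrder

variable {n : ℕ}

/-- `(p cᵀ) u = (c · u) p` for the rank-one matrix `vecMulVec p c`. [folklore] -/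
theorem vecMulVec_mulVec_eq_smul (p c u : Fin n → ℂ) :
    vecMulVec p c *ᵥ u = (c ⬝ᵥ u) • p := by
  ext i
  simp [mulVec, dotProduct, vecMulVec_apply, Finset.mul_sum, mul_comm, mul_left_comm]

/-- `b · b̄ ≠ 0` for `b ≠ 0` in `ℂⁿ`. [folklore] -/
theorem dotProduct_self_star_ne_zero {b : Fin n → ℂ} (hb : b ≠ 0) : b ⬝ᵥ star b ≠ 0 :=
  fun h => hb (dotProduct_self_star_eq_zero.1 h)

/-- The normalised rank-one direction `X = p (b/(b·b̄))ᵀ` sends `b̄` to `p`. [folklore] -/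
theorem rankOne_mulVec_star_self {b : Fin n → ℂ} (hb : b ≠ 0) (p : Fin n → ℂ) :
    vecMulVec p ((b ⬝ᵥ star b)⁻¹ • b) *ᵥ star b = p := by
  rw [vecMulVec_mulVec_eq_smul, smul_dotProduct, smul_eq_mul,
    inv_mul_cancel₀ (dotProduct_self_star_ne_zero hb), one_smul]

/-- Its transpose sends `ā` to `(p · ā) (b/(b·b̄))`. [folklore] -/
theorem rankOne_transpose_mulVec {b : Fin n → ℂ} (p a : Fin n → ℂ) :
    (vecMulVec p ((b ⬝ᵥ star b)⁻¹ • b))ᵀ *ᵥ star a = (p ⬝ᵥ star a) • ((b ⬝ᵥ star b)⁻¹ • b) := by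
  rw [transpose_vecMulVec, vecMulVec_mulVec_eq_smul]

/-- From a vector `(0, b)`, `b ≠ 0`, in a Weil-stable subspace one reaches every `(p, 0)`:
apply the direction `X = p (b/(b·b̄))ᵀ`. [folklore] -/
theorem fst_mem_of_snd_mem {S : Submodule ℂ ((Fin n → ℂ) × (Fin n → ℂ))}
    (hS : ∀ X : Matrix (Fin n) (Fin n) ℂ, ∀ v ∈ S, (X *ᵥ star v.2, Xᵀ *ᵥ star v.1) ∈ S)
    {b : Fin n → ℂ} (hb : b ≠ 0) (hbS : ((0 : Fin n → ℂ), b) ∈ S) (p : Fin n → ℂ) :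
    (p, (0 : Fin n → ℂ)) ∈ S := by
  have h := hS (vecMulVec p ((b ⬝ᵥ star b)⁻¹ • b)) _ hbS
  dsimp only at h
  rwa [rankOne_mulVec_star_self hb, star_zero, mulVec_zero] at h

/-- From a vector `(a, 0)`, `a ≠ 0`, in a Weil-stable subspace one reaches every `(0, q)`:
apply the direction `X = (a/(a·ā)) qᵀ`. [folklore] -/
theorem snd_mem_of_fst_mem {S : Submodule ℂ ((Fin n → ℂ) × (Fin n → ℂ))}
    (hS : ∀ X : Matrix (Fin n) (Fin n) ℂ, ∀ v ∈ S, (X *ᵥ star v.2, Xᵀ *ᵥ star v.1) ∈ S)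
    {a : Fin n → ℂ} (ha : a ≠ 0) (haS : (a, (0 : Fin n → ℂ)) ∈ S) (q : Fin n → ℂ) :
    ((0 : Fin n → ℂ), q) ∈ S := by
  have h := hS (vecMulVec q ((a ⬝ᵥ star a)⁻¹ • a))ᵀ _ haS
  dsimp only at h
  rwa [transpose_transpose, rankOne_mulVec_star_self ha, star_zero, mulVec_zero] at h

/-- The all-ones vector of `ℂⁿ`, `n ≥ 1`, is non-zero. [folklore] -/
theorem ones_ne_zero (hn : 1 ≤ n) : (fun _ : Fin n => (1 : ℂ)) ≠ 0 := by
  intro h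
  have := congrFun h ⟨0, hn⟩
  simp at this

/-- A Weil-stable subspace containing some `(a, 0)` with `a ≠ 0` is everything. [folklore] -/
theorem eq_top_of_fst_mem {S : Submodule ℂ ((Fin n → ℂ) × (Fin n → ℂ))} (hn : 1 ≤ n)
    (hS : ∀ X : Matrix (Fin n) (Fin n) ℂ, ∀ v ∈ S, (X *ᵥ star v.2, Xᵀ *ᵥ star v.1) ∈ S)
    {a : Fin n → ℂ} (ha : a ≠ 0) (haS : (a, (0 : Fin n → ℂ)) ∈ S) : S = ⊤ := by
  have hq : ∀ q : Fin n → ℂ, ((0 : Fin n → ℂ), q) ∈ S := snd_mem_of_fst_mem hS ha haS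
  have hp : ∀ p : Fin n → ℂ, (p, (0 : Fin n → ℂ)) ∈ S :=
    fst_mem_of_snd_mem hS (ones_ne_zero hn) (hq _)
  refine eq_top_iff.2 fun v _ => ?_
  have hv : v = (v.1, (0 : Fin n → ℂ)) + ((0 : Fin n → ℂ), v.2) := by ext <;> simp
  rw [hv]
  exact S.add_mem (hp v.1) (hq v.2)

/-- A Weil-stable subspace containing some `(0, b)` with `b ≠ 0` is everything. [folklore] -/
theorem eq_top_of_snd_mem {S : Submodule ℂ ((Fin n → ℂ) × (Fin n → ℂ))} (hn : 1 ≤ n)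
    (hS : ∀ X : Matrix (Fin n) (Fin n) ℂ, ∀ v ∈ S, (X *ᵥ star v.2, Xᵀ *ᵥ star v.1) ∈ S)
    {b : Fin n → ℂ} (hb : b ≠ 0) (hbS : ((0 : Fin n → ℂ), b) ∈ S) : S = ⊤ :=
  eq_top_of_fst_mem hn hS (ones_ne_zero hn) (fst_mem_of_snd_mem hS hb hbS _)

/-- In `ℂⁿ`, `n ≥ 2`, every vector `a ≠ 0` has a NON-ZERO vector `p` with `p · ā = 0`
(explicit: `p = ā_k e_j - ā_j e_k` with `a_j ≠ 0`, `k ≠ j`). [folklore] -/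
theorem exists_ne_zero_dotProduct_star_eq_zero (hn : 2 ≤ n) {a : Fin n → ℂ} (ha : a ≠ 0) :
    ∃ p : Fin n → ℂ, p ≠ 0 ∧ p ⬝ᵥ star a = 0 := by
  obtain ⟨j, hj⟩ : ∃ j, a j ≠ 0 := by
    by_contra h
    push Not at h
    exact ha (funext h)
  obtain ⟨k, hk⟩ : ∃ k : Fin n, k ≠ j := by
    by_cases h0 : j = ⟨0, by omega⟩
    · exact ⟨⟨1, by omega⟩, by rw [h0]; simp [Fin.ext_iff]⟩
    · exact ⟨⟨0, by omega⟩, fun h => h0 h.symm⟩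
  refine ⟨Pi.single j (star (a k)) - Pi.single k (star (a j)), ?_, ?_⟩
  · intro h
    have := congrFun h k
    simp [hk, hj] at this
  · simp [sub_dotProduct, mul_comm]

/-- Brane no-go, binder form (see `braneNoGo`): for `n ≥ 2` a Weil-stable subspace of `ℂⁿ × ℂⁿ` is
`⊥` or `⊤`. [folklore] -/
theorem eq_bot_or_eq_top_of_weilStable (hn : 2 ≤ n) (S : Submodule ℂ ((Fin n → ℂ) × (Fin n → ℂ)))
    (hS : ∀ X : Matrix (Fin n) (Fin n) ℂ, ∀ v ∈ S, (X *ᵥ star v.2, Xᵀ *ᵥ star v.1) ∈ S) :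
    S = ⊥ ∨ S = ⊤ := by
  by_cases hbot : S = ⊥
  · exact Or.inl hbot
  right
  obtain ⟨v, hvS, hv⟩ := (Submodule.ne_bot_iff S).1 hbot
  obtain ⟨a, b⟩ := v
  have hn1 : 1 ≤ n := by omega
  by_cases hb : b = 0
  · subst hb
    have ha : a ≠ 0 := by
      rintro rfl
      exact hv rfl
    exact eq_top_of_fst_mem hn1 hS ha hvS
  · by_cases ha : a = 0
    · subst ha
      exact eq_top_of_snd_mem hn1 hS hb hvS
    · -- reach a non-zero `(p, 0)` with `p ⊥ ā` through the direction `X = p (b/(b·b̄))ᵀ`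
      obtain ⟨p, hp, hpa⟩ := exists_ne_zero_dotProduct_star_eq_zero hn ha
      have h := hS (vecMulVec p ((b ⬝ᵥ star b)⁻¹ • b)) _ hvS
      dsimp only at h
      rw [rankOne_mulVec_star_self hb, rankOne_transpose_mulVec, hpa, zero_smul] at h
      exact eq_top_of_fst_mem hn1 hS hp h

/-- **Brane no-go** (`IdeatorThreeSketch.BraneNoGo` VERBATIM, card `klein-square-cm-branes`, PROVED): for
`n ≥ 2` the only complex subspaces of `ℂⁿ × ℂⁿ` stable under every Weil-direction operator
`(a, b) ↦ (X · b̄, Xᵀ · ā)`, `X ∈ Mₙ(ℂ)`, are `⊥` and `⊤`.  (At the CM-split anchor `Eⁿ × Ēⁿ` of a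
Weil `2n`-fold this says: no proper non-zero abelian subvariety deforms to first order in all `n²`
Weil directions.) [folklore] -/
theorem braneNoGo :
    ∀ n : ℕ, 2 ≤ n → ∀ S : Submodule ℂ ((Fin n → ℂ) × (Fin n → ℂ)),
      (∀ X : Matrix (Fin n) (Fin n) ℂ, ∀ v ∈ S, (X *ᵥ star v.2, Xᵀ *ᵥ star v.1) ∈ S) → S = ⊥ ∨ S = ⊤ :=
  fun _ hn S hS => eq_bot_or_eq_top_of_weilStable hn S hS

/-- **The rank-one exception** (`IdeatorThreeSketch.BraneNoGoRankOneException`, PROVED): for `n = 1`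
and `|m| = 1` the line `ℂ · (1, m)` IS stable under every Weil-direction operator (persistence of the
graph `Δ_m ⊂ E_t × E_t`). [folklore] -/
theorem braneNoGo_rankOne_exception (m : ℂ) (hm : m * star m = 1) (X : Matrix (Fin 1) (Fin 1) ℂ)
    (v : (Fin 1 → ℂ) × (Fin 1 → ℂ))
    (hv : v ∈ Submodule.span ℂ ({((fun _ => 1), (fun _ => m))} : Set ((Fin 1 → ℂ) × (Fin 1 → ℂ)))) :
    (X *ᵥ star v.2, Xᵀ *ᵥ star v.1) ∈
      Submodule.span ℂ ({((fun _ => 1), (fun _ => m))} : Set ((Fin 1 → ℂ) × (Fin 1 → ℂ))) := by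
  rw [Submodule.mem_span_singleton] at hv ⊢
  obtain ⟨c, rfl⟩ := hv
  simp only [Complex.star_def] at hm
  refine ⟨X 0 0 * (starRingEnd ℂ) c * (starRingEnd ℂ) m, ?_⟩
  refine Prod.ext (funext fun i => ?_) (funext fun i => ?_)
  · obtain rfl : i = 0 := Subsingleton.elim i 0
    simp [mulVec, dotProduct]
    ring
  · obtain rfl : i = 0 := Subsingleton.elim i 0
    simp [mulVec, dotProduct]
    linear_combination (X 0 0 * (starRingEnd ℂ) c) * hm

end Summit.HodgeConjecture.HodgeConjecture.Theorems.WeilTwelvefoldsSqrtMinus7.KleinSquareCmBranes
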